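import Literature.NumberTheory.Transcendental.QuadraticRelationsLogarithmsCor14
import HarnessLib

/-!
# Roy–Waldschmidt 1997, towards Corollaire 1.4 from Corollaire 1.3: transport to a rational subspace

Support file for `QuadraticRelationsLogarithmsCor13.lean` (Corollaire 1.4 ⇐ Corollaire 1.3 of
D. Roy, M. Waldschmidt, *Approximation diophantienne et indépendance algébrique de logarithmes*,
Ann. Sci. ÉNS (4) 30 (1997), proof pp. 759–760).  The printed induction on `d` twice replaces
`ℂ^d` by a subspace defined over `ℚ` — "Par récurrence sur `d`, on peut aussi supposer que `ℂ^d`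
est le seul sous-espace de `ℂ^d` défini sur `ℚ` qui contienne `X`" and "on identifie `ker(g)` à
`ℂ^{d*}` via un isomorphisme défini sur `ℚ`" (p. 760) — and applies the statement of
Corollaire 1.4 in the smaller dimension.  This file PROVES that transport step
(`RoyWaldschmidt1997.cor_1_4_transport`): if the conclusion of Corollaire 1.4 holds in `ℂ^m` (for
the field `K`), then it holds for finitely generated subgroups `X ⊆ (𝓛_K ∩ K)^d` contained in a
subspace `V ⊆ ℂ^d` defined over `ℚ` of dimension `m`, with `U ⊆ V`.  The one point the paper
leaves implicit is that the identification `V ≅ ℂ^m` must send `X` into `(𝓛_K ∩ K)^m`; we choose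
rational coordinates whose coordinate forms have INTEGER coefficients (scale a rational basis of
`V` by a common denominator of a rational left inverse, `exists_integral_coordinates`), so that the
coordinates of `x ∈ X` are `ℤ`-combinations of the `xⱼ` and their exponentials are monomials in the
`e^{xⱼ} ∈ K`.

Also: the rank bookkeeping `rang_ℤ(Y/(Y ∩ W)) + rang_ℤ(Y ∩ W) = rang_ℤ Y`
(`finrank_quotient_add_finrank_inf`).  Everything is proved; no definitions, no named facts.

## References

* [RoyWaldschmidt1997ENS] D. Roy, M. Waldschmidt, Ann. Sci. ÉNS (4) 30 (1997) 753–796,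
  Corollaire 1.4 and its proof, pp. 759–760 (lit key paper:doi-10-1016-s0012-9593-97-89938-7).
-/

noncomputable section

open Complex IntermediateField Module Submodule
open scoped Matrix

namespace Literature.NumberTheory.Transcendental

namespace RoyWaldschmidt1997

open LiePresentation

variable {d : ℕ}

/-! ### Rank bookkeeping for finitely generated subgroups of `ℂ^d` -/

/-- `rang_ℤ(Y/(Y ∩ W)) + rang_ℤ(Y ∩ W) = rang_ℤ(Y)` for a finitely generated subgroup `Y` of `ℂ^d`
and a subspace `W`. [folklore] -/
theorem finrank_quotient_add_finrank_inf (Y : Submodule ℤ (Fin d → ℂ)) (hY : Y.FG)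
    (W : Submodule ℂ (Fin d → ℂ)) :
    Module.finrank ℤ (↥Y ⧸ (W.restrictScalars ℤ).comap Y.subtype) +
      Module.finrank ℤ ↥(Y ⊓ W.restrictScalars ℤ) = Module.finrank ℤ ↥Y := by
  haveI : Module.Finite ℤ Y := Module.Finite.iff_fg.mpr hY
  rw [← Submodule.finrank_quotient_add_finrank ((W.restrictScalars ℤ).comap Y.subtype)]
  congr 1
  have e1 : ((W.restrictScalars ℤ).comap Y.subtype).map Y.subtype = Y ⊓ W.restrictScalars ℤ :=
    Submodule.map_comap_subtype _ _
  exact (LinearEquiv.finrank_eq ((Submodule.equivMapOfInjective _ Y.injective_subtype _).trans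
    (LinearEquiv.ofEq _ _ e1))).symm

/-- `rang_ℤ(g(Y)) + rang_ℤ(Y ∩ ker g) = rang_ℤ(Y)` for a finitely generated subgroup `Y` of `ℂ^d`
and a linear map `g`. [folklore] -/
theorem finrank_map_add_finrank_inf_ker {d' : ℕ} (Y : Submodule ℤ (Fin d → ℂ)) (hY : Y.FG)
    (g : (Fin d → ℂ) →ₗ[ℂ] (Fin d' → ℂ)) :
    Module.finrank ℤ ↥(Y.map (g.restrictScalars ℤ)) +
      Module.finrank ℤ ↥(Y ⊓ (LinearMap.ker g).restrictScalars ℤ) = Module.finrank ℤ ↥Y := by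
  rw [← finrank_quotient_add_finrank_inf Y hY (LinearMap.ker g)]
  congr 1
  let ψ : ↥Y →ₗ[ℤ] (Fin d' → ℂ) := (g.restrictScalars ℤ).comp Y.subtype
  have hker : LinearMap.ker ψ = ((LinearMap.ker g).restrictScalars ℤ).comap Y.subtype := by
    rw [LinearMap.ker_comp]; rfl
  have hrange : LinearMap.range ψ = Y.map (g.restrictScalars ℤ) := by
    rw [LinearMap.range_comp, Submodule.range_subtype]
  have e := (Submodule.quotEquivOfEq _ _ hker).symm.trans (ψ.quotKerEquivRange.trans
    (LinearEquiv.ofEq _ _ hrange))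
  exact (LinearEquiv.finrank_eq e).symm

/-! ### Integral coordinates on a rational subspace -/

/-- A rational linear map `ℚ^d → ℚ^m` in coordinates: `(A w)ₖ = ∑ⱼ A(eⱼ)ₖ wⱼ`. [folklore] -/
theorem linearMap_apply_eq_sum {m : ℕ} (A : (Fin d → ℚ) →ₗ[ℚ] (Fin m → ℚ)) (w : Fin d → ℚ)
    (k : Fin m) : A w k = ∑ j, A (Pi.single j 1) k * w j := by
  conv_lhs => rw [show w = ∑ j, w j • (Pi.single j (1 : ℚ) : Fin d → ℚ) from by
    funext i; simp [Finset.sum_apply, Pi.single_apply]]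
  simp [map_sum, map_smul, Finset.sum_apply, mul_comm]

/-- **Integral coordinates on a subspace defined over `ℚ`.**  A subspace `V ⊆ ℂ^d` defined over
`ℚ` of dimension `m` has a basis of rational vectors `v₁, …, v_m` together with an INTEGER matrix
`Z` (`m × d`) whose rows are coordinate forms: `∑ⱼ Z_{kj} (vᵢ)ⱼ = δ_{ki}`.  (Take a rational basis,
a rational left inverse of `c ↦ ∑ cᵢvᵢ`, and divide the basis by a common denominator of its
entries.) [folklore] -/
theorem exists_integral_coordinates {V : Submodule ℂ (Fin d → ℂ)} (hV : IsKRational ℚ V) :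
    ∃ (m : ℕ) (v : Fin m → Fin d → ℚ) (Z : Fin m → Fin d → ℤ),
      Module.finrank ℂ V = m ∧
      LinearIndependent ℂ (fun i => ofK ℚ (L := ℂ) (v i)) ∧
      V = span ℂ (Set.range fun i => ofK ℚ (L := ℂ) (v i)) ∧
      ∀ k i, ∑ j, (Z k j : ℚ) * v i j = if k = i then 1 else 0 := by
  classical
  -- a rational basis of `V`
  let Vq : Submodule ℚ (Fin d → ℚ) := kPoints ℚ V
  let m := Module.finrank ℚ Vq
  let b : Basis (Fin m) ℚ Vq := Module.finBasis ℚ Vq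
  let u : Fin m → Fin d → ℚ := fun i => (b i : Fin d → ℚ)
  have hu : LinearIndependent ℚ u := b.linearIndependent.map' Vq.subtype (Submodule.ker_subtype Vq)
  -- a rational left inverse of `c ↦ ∑ cᵢ uᵢ`
  let ι₀ : (Fin m → ℚ) →ₗ[ℚ] (Fin d → ℚ) :=
    ∑ i, (LinearMap.proj i : (Fin m → ℚ) →ₗ[ℚ] ℚ).smulRight (u i)
  have hι₀ : ∀ c, ι₀ c = ∑ i, c i • u i := fun c => by simp [ι₀, LinearMap.sum_apply]
  have hι₀inj : LinearMap.ker ι₀ = ⊥ := by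
    rw [LinearMap.ker_eq_bot']
    intro c hc
    rw [hι₀] at hc
    exact funext fun i => Fintype.linearIndependent_iff.mp hu c hc i
  obtain ⟨A₀, hA₀⟩ := ι₀.exists_leftInverse_of_injective hι₀inj
  have hA₀u : ∀ i k, ∑ j, A₀ (Pi.single j 1) k * u i j = if k = i then 1 else 0 := by
    intro i k
    rw [← linearMap_apply_eq_sum]
    have : A₀ (ι₀ (Pi.single i 1)) = Pi.single i 1 := by
      rw [← LinearMap.comp_apply, hA₀, LinearMap.id_apply]
    rw [hι₀] at this
    simp [Pi.single_apply] at this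
    rw [this, Pi.single_apply]
  -- a common denominator `N` of the entries of `A₀`
  let N : ℕ := ∏ k : Fin m, ∏ j : Fin d, (A₀ (Pi.single j 1) k).den
  have hNpos : 0 < N := Finset.prod_pos fun k _ => Finset.prod_pos fun j _ => Rat.den_pos _
  have hNint : ∀ k j, ∃ z : ℤ, (N : ℚ) * A₀ (Pi.single j 1) k = z := by
    intro k j
    set q := A₀ (Pi.single j 1) k with hq
    have hdvd : q.den ∣ N := by
      refine (Finset.dvd_prod_of_mem _ (Finset.mem_univ j)).trans
        (Finset.dvd_prod_of_mem (fun k => ∏ j : Fin d, (A₀ (Pi.single j 1) k).den) (Finset.mem_univ k))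
    obtain ⟨c, hc⟩ := hdvd
    refine ⟨c * q.num, ?_⟩
    have : q * q.den = q.num := Rat.mul_den_eq_num q
    rw [hc, Nat.cast_mul, Int.cast_mul, Int.cast_natCast, ← this]
    ring
  choose Z hZ using hNint
  -- the scaled basis `v = u / N`
  let v : Fin m → Fin d → ℚ := fun i j => u i j / N
  have hNq : (N : ℚ) ≠ 0 := by exact_mod_cast hNpos.ne'
  have hvu : ∀ i, ofK ℚ (L := ℂ) (v i) = ((N : ℚ) : ℂ)⁻¹ • ofK ℚ (L := ℂ) (u i) := by
    intro i; funext j; simp [v, ofK, div_eq_inv_mul]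
  have hNc : ((N : ℚ) : ℂ) ≠ 0 := by exact_mod_cast hNq
  -- `ℂ`-independence and span of the complexified basis
  have hli_u : LinearIndependent ℂ (fun i => ofK ℚ (L := ℂ) (u i)) := by
    have e : (fun i => ofK ℚ (L := ℂ) (u i)) = fun i => (algebraMap ℚ ℂ) ∘ (u i) := rfl
    rw [e]
    exact (linearIndependent_algebraMap_comp_iff (R := ℚ) (S := ℂ)).mpr hu
  have hli : LinearIndependent ℂ (fun i => ofK ℚ (L := ℂ) (v i)) := by
    simp_rw [hvu]
    exact hli_u.units_smul fun _ => Units.mk0 _ (inv_ne_zero hNc)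
  have hspan_u : V = span ℂ (Set.range fun i => ofK ℚ (L := ℂ) (u i)) := by
    refine le_antisymm ?_ (span_le.mpr ?_)
    · rw [hV.eq_span_kPoints]
      refine span_le.mpr ?_
      rintro _ ⟨w, hw, rfl⟩
      have hrepr := b.sum_repr ⟨w, hw⟩
      have hw' : w = ∑ i, (b.repr ⟨w, hw⟩ i) • u i := by
        have h1 := congrArg Subtype.val hrepr
        simp only [Submodule.coe_sum, Submodule.coe_smul] at h1
        exact h1.symm
      rw [hw', ofK_sum_smul]
      exact Submodule.sum_mem _ fun i _ => Submodule.smul_mem _ _ (subset_span ⟨i, rfl⟩)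
    · rintro _ ⟨i, rfl⟩
      exact (b i).2
  have hspan : V = span ℂ (Set.range fun i => ofK ℚ (L := ℂ) (v i)) := by
    rw [hspan_u]
    refine le_antisymm (span_le.mpr ?_) (span_le.mpr ?_)
    · rintro _ ⟨i, rfl⟩
      have : ofK ℚ (L := ℂ) (u i) = ((N : ℚ) : ℂ) • ofK ℚ (L := ℂ) (v i) := by
        rw [hvu, smul_smul, mul_inv_cancel₀ hNc, one_smul]
      change ofK ℚ (L := ℂ) (u i) ∈ _
      rw [this]
      exact Submodule.smul_mem _ _ (subset_span ⟨i, rfl⟩)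
    · rintro _ ⟨i, rfl⟩
      change ofK ℚ (L := ℂ) (v i) ∈ _
      rw [hvu]
      exact Submodule.smul_mem _ _ (subset_span ⟨i, rfl⟩)
  refine ⟨m, v, Z, ?_, hli, hspan, fun k i => ?_⟩
  · rw [hspan, finrank_span_eq_card hli, Fintype.card_fin]
  · have h := hA₀u i k
    simp only [v]
    rw [← h]
    refine Finset.sum_congr rfl fun j _ => ?_
    rw [← hZ k j]
    field_simp

/-- **Transport of Corollaire 1.4 to a subspace defined over `ℚ`** (the implicit step of the
printed induction, p. 760: "on identifie … à `ℂ^{d*}` via un isomorphisme défini sur `ℚ`").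
If the conclusion of Corollaire 1.4 holds for the finitely generated subgroups of
`(𝓛_K ∩ K)^m`, `m = dim V`, then for a finitely generated subgroup `X` of `(𝓛_K ∩ K)^d`
contained in the subspace `V ⊆ ℂ^d` defined over `ℚ` there is `U ⊆ V` defined over `ℚ` with
`rang_ℤ(X/(X ∩ U)) + dim U ≤ 2 dim ℂX`, strictly if `X ∩ 𝓛^d ≠ 0`.
[cite: RoyWaldschmidt1997ENS, proof of Corollaire 1.4, pp. 759–760] -/
theorem cor_1_4_transport (K : IntermediateField ℚ ℂ) {m : ℕ}
    (hP : ∀ (Y : Submodule ℤ (Fin m → ℂ)), Y.FG → (∀ y ∈ Y, ∀ i, y i ∈ K ∧ cexp (y i) ∈ K) →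
      ∃ U : Submodule ℂ (Fin m → ℂ), (∃ s : Set (Fin m → ℚ), U = ratSpan s) ∧
        Module.finrank ℤ (↥Y ⧸ (U.restrictScalars ℤ).comap Y.subtype) + Module.finrank ℂ U ≤
          2 * Module.finrank ℂ (span ℂ (Y : Set (Fin m → ℂ))) ∧
        ((∃ y ∈ Y, y ≠ 0 ∧ ∀ i, IsAlgebraic ℚ (cexp (y i))) →
          Module.finrank ℤ (↥Y ⧸ (U.restrictScalars ℤ).comap Y.subtype) + Module.finrank ℂ U <
            2 * Module.finrank ℂ (span ℂ (Y : Set (Fin m → ℂ)))))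
    {V : Submodule ℂ (Fin d → ℂ)} (hV : IsKRational ℚ V) (hVm : Module.finrank ℂ V = m)
    (X : Submodule ℤ (Fin d → ℂ)) (hX : X.FG) (hXV : X ≤ V.restrictScalars ℤ)
    (hXK : ∀ x ∈ X, ∀ i, x i ∈ K ∧ cexp (x i) ∈ K) :
    ∃ U : Submodule ℂ (Fin d → ℂ), (∃ s : Set (Fin d → ℚ), U = ratSpan s) ∧ U ≤ V ∧
      Module.finrank ℤ (↥X ⧸ (U.restrictScalars ℤ).comap X.subtype) + Module.finrank ℂ U ≤
        2 * Module.finrank ℂ (span ℂ (X : Set (Fin d → ℂ))) ∧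
      ((∃ x ∈ X, x ≠ 0 ∧ ∀ i, IsAlgebraic ℚ (cexp (x i))) →
        Module.finrank ℤ (↥X ⧸ (U.restrictScalars ℤ).comap X.subtype) + Module.finrank ℂ U <
          2 * Module.finrank ℂ (span ℂ (X : Set (Fin d → ℂ)))) := by
  classical
  obtain ⟨m', v, Z, hm', hli, hVspan, hZv⟩ := exists_integral_coordinates hV
  have hmm : m' = m := hm'.symm.trans hVm
  subst hmm
  -- the coordinate isomorphism `ι : ℂ^m → V` and its integral left inverse `A`
  let ι : (Fin m' → ℂ) →ₗ[ℂ] (Fin d → ℂ) :=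
    ∑ i, (LinearMap.proj i : (Fin m' → ℂ) →ₗ[ℂ] ℂ).smulRight (ofK ℚ (L := ℂ) (v i))
  have hι : ∀ c, ι c = ∑ i, c i • ofK ℚ (L := ℂ) (v i) := fun c => by simp [ι, LinearMap.sum_apply]
  let A : (Fin d → ℂ) →ₗ[ℂ] (Fin m' → ℂ) :=
    { toFun := fun x k => ∑ j, (Z k j : ℂ) * x j
      map_add' := fun x y => by funext k; simp [mul_add, Finset.sum_add_distrib]
      map_smul' := fun c x => by funext k; simp [Finset.mul_sum, mul_left_comm] }
  have hA : ∀ x k, A x k = ∑ j, (Z k j : ℂ) * x j := fun x k => rfl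
  have hAι : ∀ c, A (ι c) = c := by
    intro c; funext k
    rw [hA, hι]
    simp only [Finset.sum_apply, Pi.smul_apply, ofK_apply, smul_eq_mul, eq_ratCast, Finset.mul_sum]
    rw [Finset.sum_comm]
    have : ∀ i, ∑ j, (Z k j : ℂ) * (c i * ((v i j : ℚ) : ℂ)) = c i * (if k = i then 1 else 0) := by
      intro i
      have h := congrArg (fun q : ℚ => (q : ℂ)) (hZv k i)
      simp only [Rat.cast_sum, Rat.cast_mul, Rat.cast_intCast, apply_ite (Rat.cast : ℚ → ℂ),
        Rat.cast_one, Rat.cast_zero] at h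
      rw [← h, Finset.mul_sum]
      exact Finset.sum_congr rfl fun j _ => by ring
    simp only [this, mul_ite, mul_one, mul_zero, Finset.sum_ite_eq, Finset.mem_univ, if_true]
  have hιinj : Function.Injective ι := fun c c' h => by
    have := congrArg A h; rwa [hAι, hAι] at this
  have hrange : LinearMap.range ι = V := by
    rw [hVspan]
    refine le_antisymm ?_ (span_le.mpr ?_)
    · rintro _ ⟨c, rfl⟩
      rw [hι]
      exact Submodule.sum_mem _ fun i _ => Submodule.smul_mem _ _ (subset_span ⟨i, rfl⟩)
    · rintro _ ⟨i, rfl⟩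
      refine ⟨Pi.single i 1, ?_⟩
      rw [hι, Finset.sum_eq_single i]
      · simp
      · intro j _ hji; simp [hji]
      · simp
  have hιA : ∀ x ∈ V, ι (A x) = x := by
    intro x hx
    rw [← hrange] at hx
    obtain ⟨c, rfl⟩ := hx
    rw [hAι]
  -- rationality of `ι` and `A`
  have hιrat : ∀ c₀ : Fin m' → ℚ, ι (ofK ℚ c₀) = ofK ℚ (∑ i, c₀ i • v i) := by
    intro c₀; rw [hι, ofK_sum_smul]
    refine Finset.sum_congr rfl fun i _ => ?_
    simp [ofK, Algebra.smul_def]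
  -- the transported subgroup
  let Aℤ : (Fin d → ℂ) →ₗ[ℤ] (Fin m' → ℂ) := A.restrictScalars ℤ
  let ιℤ : (Fin m' → ℂ) →ₗ[ℤ] (Fin d → ℂ) := ι.restrictScalars ℤ
  let Y : Submodule ℤ (Fin m' → ℂ) := X.map Aℤ
  have hYfg : Y.FG := hX.map _
  have hYK : ∀ y ∈ Y, ∀ k, y k ∈ K ∧ cexp (y k) ∈ K := by
    rintro _ ⟨x, hx, rfl⟩ k
    change A x k ∈ K ∧ cexp (A x k) ∈ K
    rw [hA]
    refine ⟨sum_mem fun j _ => mul_mem (intCast_mem K _) (hXK x hx j).1, ?_⟩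
    rw [Complex.exp_sum]
    refine prod_mem fun j _ => ?_
    rw [Complex.exp_int_mul]
    exact zpow_mem (hXK x hx j).2 _
  have hYX : Y.map ιℤ = X := by
    refine le_antisymm ?_ fun x hx => ?_
    · rintro _ ⟨_, ⟨x, hx, rfl⟩, rfl⟩
      change ι (A x) ∈ X
      rw [hιA x (hXV hx)]; exact hx
    · exact ⟨A x, ⟨x, hx, rfl⟩, hιA x (hXV hx)⟩
  -- Corollaire 1.4 in `ℂ^m`
  obtain ⟨U', ⟨s', hUs'⟩, hle', hlt'⟩ := hP Y hYfg hYK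
  let U : Submodule ℂ (Fin d → ℂ) := U'.map ι
  have hUrat : ∃ s : Set (Fin d → ℚ), U = ratSpan s := by
    refine ⟨(fun c₀ => ∑ i, c₀ i • v i) '' s', ?_⟩
    simp only [U, hUs', ratSpan, Submodule.map_span, ← Set.image_comp]
    refine congrArg _ (Set.image_congr fun c₀ _ => ?_)
    exact hιrat c₀
  have hUV : U ≤ V := by rw [← hrange]; exact LinearMap.map_le_range
  -- the numerical invariants agree
  have hfinU : Module.finrank ℂ U = Module.finrank ℂ U' :=
    (LinearEquiv.finrank_eq (Submodule.equivMapOfInjective ι hιinj U')).symm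
  have hspanXY : span ℂ (X : Set (Fin d → ℂ)) = (span ℂ (Y : Set (Fin m' → ℂ))).map ι := by
    rw [Submodule.map_span, ← hYX]; rfl
  have hfinspan : Module.finrank ℂ (span ℂ (X : Set (Fin d → ℂ))) =
      Module.finrank ℂ (span ℂ (Y : Set (Fin m' → ℂ))) := by
    rw [hspanXY]
    exact (LinearEquiv.finrank_eq (Submodule.equivMapOfInjective ι hιinj _)).symm
  have hιℤinj : Function.Injective ιℤ := hιinj
  have hfinX : Module.finrank ℤ ↥X = Module.finrank ℤ ↥Y := by
    rw [← hYX]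
    exact (LinearEquiv.finrank_eq (Submodule.equivMapOfInjective ιℤ hιℤinj Y)).symm
  have hinf : X ⊓ U.restrictScalars ℤ = (Y ⊓ U'.restrictScalars ℤ).map ιℤ := by
    rw [Submodule.map_inf ιℤ hιℤinj, hYX]
    congr 1
  have hfininf : Module.finrank ℤ ↥(X ⊓ U.restrictScalars ℤ) =
      Module.finrank ℤ ↥(Y ⊓ U'.restrictScalars ℤ) := by
    rw [hinf]
    exact (LinearEquiv.finrank_eq (Submodule.equivMapOfInjective ιℤ hιℤinj _)).symm
  have hq := finrank_quotient_add_finrank_inf X hX U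
  have hq' := finrank_quotient_add_finrank_inf Y hYfg U'
  refine ⟨U, hUrat, hUV, ?_, fun hx => ?_⟩
  · rw [hfinU, hfinspan]; omega
  · obtain ⟨x, hx, hx0, hxalg⟩ := hx
    have hy : ∃ y ∈ Y, y ≠ 0 ∧ ∀ i, IsAlgebraic ℚ (cexp (y i)) := by
      refine ⟨A x, ⟨x, hx, rfl⟩, fun h0 => hx0 ?_, fun k => ?_⟩
      · rw [← hιA x (hXV hx), h0, map_zero]
      · rw [hA]
        have := isAlgebraic_cexp_sum_rat_mul hxalg (fun j => (Z k j : ℚ))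
        simpa using this
    have := hlt' hy
    rw [hfinU, hfinspan]; omega

end RoyWaldschmidt1997

end Literature.NumberTheory.Transcendental
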